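import Mathlib.Analysis.Normed.Lp.SmoothApprox
import Literature.Analysis.FluidPDE.NormalisedPressureLpBoundProofs
import Literature.Analysis.FluidPDE.NormalisedPressureCompactSupport
import Literature.Analysis.FluidPDE.NecasRuzickaSverakPressure
import Literature.Analysis.FluidPDE.PoincareBall
import HarnessLib

/-!
# The Riesz-transform pressure of an `L^{2q}` field: discharge of `nrs1996_rieszPressure`

Analysis/FluidPDE proofs file (family NS, statement ns.S21), fourth and last layer of the
decomposition of the named fact `Literature.Analysis.FluidPDE.necas_ruzicka_sverak`
(`SelfSimilarLiouville.lean`; J. Nečas, M. Růžička, V. Šverák, Acta Math. 176 (1996) 283–294,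
Theorem 1). The third layer (`NecasRuzickaSverakPressure.lean`) left one named fact specific to
the Nečas–Růžička–Šverák theorem, the Calderón–Zygmund statement of their §2, p. 285:

> `nrs1996_rieszPressure`: for `1 < q < ∞` there is `C` such that every `U ∈ L^{2q}(ℝ³; ℝ³)`
> admits `Q ∈ L^q` with `∫ |Q|^q ≤ C ∫ |U|^{2q}` and `∫ Q Δφ = −∫ D²φ(U, U)` for all
> `φ ∈ C_c^∞` (the Riesz pressure `P = RⱼRₖ(UⱼUₖ)`, in existence form).

This file **proves it** (`nrs1996_rieszPressure_holds`) from the tree's Calderón–Zygmund theory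
for the normalised pressure `p̃[w] = -Δ⁻¹∂ᵢ∂ⱼ(wᵢwⱼ)` of a test field
(`stein1970_normalisedPressure_Lp_bound_holds`, or rather the uniform bound for the regularised
pressures `Q_ε[w]` behind it, `exists_eLpNorm_regPressure_le` of
`NormalisedPressureLpBoundProofs`; and the weak pressure Poisson equation
`integral_normalisedPressure_mul_laplacian` of `NormalisedPressureCompactSupport`) by the
standard approximation argument (NRŠ: "we can use the classical Riesz transformation to solve
(2.2)"; Tsai 1998, proof of Lemma 2.1, p. 34: "(2.5) can be established for `U ∈ C_c^∞ ⊂ L²`.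
We then extend this result to general `U ∈ L^q` by approximation"):

* §1–§2 **Differences of pressures.** `Q_ε[·]` is a quadratic form through the symmetric
  bilinear Hessian `D²Φ_ε`, so `Q_ε[v] − Q_ε[w] = ¼(Q_ε[t(v+w) + t⁻¹(v−w)] − Q_ε[t(v+w) − t⁻¹(v−w)])`
  for every `t ≠ 0` (`regPressure_sub_eq_polarisation`); with the uniform `L^P` bound
  `‖Q_ε[w]‖_P ≤ C ‖|w|²‖_P = C ‖w‖²_{2P}` this gives
  `‖Q_ε[v] − Q_ε[w]‖_P ≤ C (2t² ‖v + w‖²_{2P} + 2t⁻² ‖v − w‖²_{2P})`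
  (`eLpNorm_regPressure_sub_le`), and Fatou along `ε = 1/(n+1)` transfers both bounds to the
  normalised pressures `p̃[w] = lim Q_ε[w]` (`eLpNorm_normalisedPressure_le_of_reg`,
  `eLpNorm_normalisedPressure_sub_le_of_reg`).
* §3 **Two Hölder convergence lemmas**: pairings `∫ gₙ ψ → 0` when `‖gₙ‖_P → 0`, `ψ ∈ L^{P'}`
  (`tendsto_integral_mul_of_eLpNorm_tendsto_zero`), and `∫ D²φ(wₙ, wₙ) → ∫ D²φ(U, U)` when
  `wₙ → U` in `L^{2P}` (`tendsto_integral_hessian_apply_of_eLpNorm`).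
* §4 **The construction** (`exists_rieszPressure`): approximate `U` by test fields `wₙ` with
  `‖U − wₙ‖_{2P} ≤ 2⁻ⁿ` (Mathlib's `MemLp.exist_eLpNorm_sub_le`); by §2 with `t² = 2^{-N}` the
  pressures `p̃[wₙ]` form a Cauchy sequence in `L^P` with geometric control, hence converge to
  some `Q ∈ L^P` (`Lp.cauchy_complete_eLpNorm`); `‖Q‖_P ≤ C ‖U‖²_{2P}` and the weak Poisson
  equation passes to the limit by §3.
* §5 `nrs1996_rieszPressure_holds`, hence `nrs1996_lemma31_holds` and
  `necas_ruzicka_sverak_of_CKN : tsai1998_profile_smooth → tsai1998_lemma32 →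
  lemarieRieusset_epsilon_regularity → necas_ruzicka_sverak`.

The weighted twin of this extension argument (Tsai's `L^{5/3}(|y|^{-5/3}dy)` setting, from the
`A_p` fact `grafakos2014_normalisedPressure_powerWeight_bound`) is the sibling
`TsaiWeightedRieszPressureProofs` (polarisation at the level of the principal values); the
present unweighted case runs the polarisation on the regularised pressures `Q_ε`, where
bilinearity is that of `D²Φ_ε`, and rests on the *proved* `L^p` bound, so that no named fact
remains below it.

After this file the named facts under `necas_ruzicka_sverak` are the regularity of profiles
(`tsai1998_profile_smooth`), Tsai's pressure growth (`tsai1998_lemma32`) and the one-scale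
Caffarelli–Kohn–Nirenberg criterion (`lemarieRieusset_epsilon_regularity`), all shared with the
decompositions of Tsai's theorems and of ns.S12; nothing specific to Nečas–Růžička–Šverák 1996
remains unproved.

## Mathlib / tree search

Mathlib (all used): `MemLp.exist_eLpNorm_sub_le` (`Analysis/Normed/Lp/SmoothApprox`),
`Lp.cauchy_complete_eLpNorm`, `Lp.eLpNorm_lim_le_liminf_eLpNorm`,
`eLpNorm_le_eLpNorm_mul_eLpNorm_of_nnnorm` (Hölder with `ENNReal.HolderTriple`),
`eLpNorm_norm_rpow`, `norm_integral_le_lintegral_norm`, `MemLp.locallyIntegrable`,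
`LocallyIntegrable.integrable_smul_right_of_hasCompactSupport`,
`ENNReal.tendsto_pow_atTop_nhds_zero_of_lt_one`, `ENNReal.tsum_geometric`. Tree:
`PoincareBall.add_sq_le_two_mul_sq_add` (`PoincareBall`);
`regPressure`, `hessReg`, `integrable_hessReg_apply_apply`, `aestronglyMeasurable_regPressure`,
`limPressure`, `normalisedPressure_eq_limPressure`, `tendsto_regPressure_nat`
(`NormalisedPressureL2Bound`); `exists_eLpNorm_regPressure_le`
(`NormalisedPressureLpBoundProofs`); `integral_normalisedPressure_mul_laplacian`,
`memLp_normalisedPressure_of_hasCompactSupport` (`NormalisedPressureCompactSupport`);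
`nrs1996_rieszPressure`, `nrs1996_lemma31_of_rieszPressure`,
`necas_ruzicka_sverak_of_rieszPressure` (`NecasRuzickaSverakPressure`).

## References

* J. Nečas, M. Růžička, V. Šverák, *On Leray's self-similar solutions of the Navier–Stokes
  equations*, Acta Math. 176 (1996) 283–294: §2, p. 285, (2.2) [NecasRuzickaSverak1996].
* T.-P. Tsai, *On Leray's self-similar solutions of the Navier–Stokes equations satisfying local
  energy estimates*, Arch. Rational Mech. Anal. 143 (1998) 29–51: Lemma 2.1 and its proof,
  (2.3), (2.5) (p. 34) [Tsai1998].
* E. M. Stein, *Singular integrals and differentiability properties of functions*, Princeton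
  (1970), Ch. II §4.2, Thm 3; Ch. III §1 [Stein1971].
-/

noncomputable section

open MeasureTheory Set Filter Topology Function Metric
open scoped ENNReal NNReal RealInnerProductSpace ContDiff Laplacian

namespace Literature.Analysis.FluidPDE

-- nested operator types `ℝ³ →L[ℝ] ℝ³ →L[ℝ] ℝ`
set_option maxSynthPendingDepth 3

/-- Local notation for physical space `ℝ³ = EuclideanSpace ℝ (Fin 3)`. -/
local notation "ℝ³" => EuclideanSpace ℝ (Fin 3)

/-! ## §1. The regularised pressures: a bilinear identity and the bound for differences -/

section Regularised

variable {v w : ℝ³ → ℝ³}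

/-- Compactly supported continuous fields are closed under the combinations
`t • (v + w) ± t⁻¹ • (v − w)`. [folklore] -/
theorem hasCompactSupport_comb (hvc : HasCompactSupport v) (hwc : HasCompactSupport w) (s t : ℝ) :
    HasCompactSupport (s • (v + w) + t • (v - w)) :=
  ((hvc.add hwc).smul_left (f := fun _ => s)).add ((hvc.sub hwc).smul_left (f := fun _ => t))

/-- **The bilinear identity behind the polarisation trick.** For the regularised pressures
`Q_ε[w](x) = -∫ D²Φ_ε(x − y)(w y, w y) dy` (a quadratic form in `w` through the symmetric bilinear
Hessian `D²Φ_ε`) and every `t ≠ 0`: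
`Q_ε[v] − Q_ε[w] = ¼ (Q_ε[t(v + w) + t⁻¹(v − w)] − Q_ε[t(v + w) − t⁻¹(v − w)])`
(pointwise, `H(s + d, s + d) − H(s − d, s − d) = 2H(s, d) + 2H(d, s)` with `s = t(a + b)`,
`d = t⁻¹(a − b)`, and the cross terms cancel). [folklore] -/
theorem regPressure_sub_eq_polarisation (hv : Continuous v) (hvc : HasCompactSupport v)
    (hw : Continuous w) (hwc : HasCompactSupport w) (ε : ℝ) {t : ℝ} (ht : t ≠ 0) (x : ℝ³) :
    regPressure ε v x - regPressure ε w x =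
      4⁻¹ * (regPressure ε (t • (v + w) + t⁻¹ • (v - w)) x -
        regPressure ε (t • (v + w) - t⁻¹ • (v - w)) x) := by
  have hpt : ∀ y, hessReg ε (x - y) (v y) (v y) - hessReg ε (x - y) (w y) (w y) =
      4⁻¹ * (hessReg ε (x - y) ((t • (v + w) + t⁻¹ • (v - w)) y) ((t • (v + w) + t⁻¹ • (v - w)) y) -
        hessReg ε (x - y) ((t • (v + w) - t⁻¹ • (v - w)) y) ((t • (v + w) - t⁻¹ • (v - w)) y)) := by
    intro y
    simp only [Pi.add_apply, Pi.sub_apply, Pi.smul_apply, map_add, map_sub, map_smul,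
      _root_.add_apply, _root_.sub_apply, FunLike.coe_smul, smul_eq_mul]
    field_simp
    ring
  have hfp : Continuous (t • (v + w) + t⁻¹ • (v - w)) :=
    ((hv.add hw).const_smul t).add ((hv.sub hw).const_smul t⁻¹)
  have hfm : Continuous (t • (v + w) - t⁻¹ • (v - w)) :=
    ((hv.add hw).const_smul t).sub ((hv.sub hw).const_smul t⁻¹)
  have hfpc : HasCompactSupport (t • (v + w) + t⁻¹ • (v - w)) := hasCompactSupport_comb hvc hwc t t⁻¹
  have hfmc : HasCompactSupport (t • (v + w) - t⁻¹ • (v - w)) := by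
    have h := hasCompactSupport_comb hvc hwc t (-t⁻¹)
    have e : t • (v + w) + (-t⁻¹) • (v - w) = t • (v + w) - t⁻¹ • (v - w) := by
      rw [neg_smul, ← sub_eq_add_neg]
    rwa [e] at h
  have iv := integrable_hessReg_apply_apply ε hv hvc x
  have iw := integrable_hessReg_apply_apply ε hw hwc x
  have ip := integrable_hessReg_apply_apply ε hfp hfpc x
  have im := integrable_hessReg_apply_apply ε hfm hfmc x
  simp only [regPressure]
  rw [show -(∫ y, hessReg ε (x - y) (v y) (v y)) - -(∫ y, hessReg ε (x - y) (w y) (w y)) =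
      -((∫ y, hessReg ε (x - y) (v y) (v y)) - ∫ y, hessReg ε (x - y) (w y) (w y)) by ring,
    ← integral_sub iv iw,
    show -(∫ y, hessReg ε (x - y) ((t • (v + w) + t⁻¹ • (v - w)) y) ((t • (v + w) + t⁻¹ • (v - w)) y)) -
        -(∫ y, hessReg ε (x - y) ((t • (v + w) - t⁻¹ • (v - w)) y) ((t • (v + w) - t⁻¹ • (v - w)) y)) =
      -((∫ y, hessReg ε (x - y) ((t • (v + w) + t⁻¹ • (v - w)) y) ((t • (v + w) + t⁻¹ • (v - w)) y)) -
        ∫ y, hessReg ε (x - y) ((t • (v + w) - t⁻¹ • (v - w)) y) ((t • (v + w) - t⁻¹ • (v - w)) y)) by ring,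
    ← integral_sub ip im]
  have hcongr : ∫ y, (hessReg ε (x - y) (v y) (v y) - hessReg ε (x - y) (w y) (w y)) =
      ∫ y, 4⁻¹ * (hessReg ε (x - y) ((t • (v + w) + t⁻¹ • (v - w)) y) ((t • (v + w) + t⁻¹ • (v - w)) y) -
        hessReg ε (x - y) ((t • (v + w) - t⁻¹ • (v - w)) y) ((t • (v + w) - t⁻¹ • (v - w)) y)) :=
    integral_congr_ae (ae_of_all _ hpt)
  rw [hcongr, integral_const_mul]
  ring

/-- **The bound for differences of regularised pressures.** If `‖Q_ε[w]‖_P ≤ C ‖|w|²‖_P` for all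
`w ∈ C_c` at a fixed scale `ε`, then for `v, w ∈ C_c` and every `t > 0`,
`‖Q_ε[v] − Q_ε[w]‖_P ≤ C (t² ‖v + w‖²_{2P} + t⁻² ‖v − w‖²_{2P})` — the polarisation identity,
`‖|f|²‖_P = ‖f‖²_{2P}`, the triangle inequality and `(a + b)² ≤ 2a² + 2b²`. [folklore] -/
theorem eLpNorm_regPressure_sub_le {P : ℝ≥0∞} (hP1 : 1 ≤ P) {C : ℝ≥0} {ε : ℝ}
    (hC : ∀ w : ℝ³ → ℝ³, Continuous w → HasCompactSupport w →
      eLpNorm (regPressure ε w) P volume ≤ C * eLpNorm (fun y => ‖w y‖ ^ 2) P volume)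
    (hv : Continuous v) (hvc : HasCompactSupport v) (hw : Continuous w) (hwc : HasCompactSupport w)
    {t : ℝ} (ht : 0 < t) :
    eLpNorm (fun x => regPressure ε v x - regPressure ε w x) P volume ≤
      C * (ENNReal.ofReal (t ^ 2) * (2 * eLpNorm (v + w) (P * 2) volume ^ 2) +
        ENNReal.ofReal (t⁻¹ ^ 2) * (2 * eLpNorm (v - w) (P * 2) volume ^ 2)) := by
  have hP21 : 1 ≤ P * 2 := hP1.trans (le_mul_of_one_le_right zero_le one_le_two)
  set fp : ℝ³ → ℝ³ := t • (v + w) + t⁻¹ • (v - w) with hfpdef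
  set fm : ℝ³ → ℝ³ := t • (v + w) - t⁻¹ • (v - w) with hfmdef
  have hfp : Continuous fp := ((hv.add hw).const_smul t).add ((hv.sub hw).const_smul t⁻¹)
  have hfm : Continuous fm := ((hv.add hw).const_smul t).sub ((hv.sub hw).const_smul t⁻¹)
  have hfpc : HasCompactSupport fp := hasCompactSupport_comb hvc hwc t t⁻¹
  have hfmc : HasCompactSupport fm := by
    have h := hasCompactSupport_comb hvc hwc t (-t⁻¹)
    have e : t • (v + w) + (-t⁻¹) • (v - w) = t • (v + w) - t⁻¹ • (v - w) := by
      rw [neg_smul, ← sub_eq_add_neg]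
    rwa [e] at h
  -- the polarisation identity as a function identity
  have hfun : (fun x => regPressure ε v x - regPressure ε w x) =
      (4⁻¹ : ℝ) • fun x => regPressure ε fp x - regPressure ε fm x := by
    funext x
    rw [Pi.smul_apply, smul_eq_mul]
    exact regPressure_sub_eq_polarisation hv hvc hw hwc ε ht.ne' x
  have hmp := aestronglyMeasurable_regPressure ε hfp hfpc
  have hmm := aestronglyMeasurable_regPressure ε hfm hfmc
  -- norms of `f±` in `L^{2P}`
  have hvm : AEStronglyMeasurable v volume := hv.aestronglyMeasurable
  have hwm : AEStronglyMeasurable w volume := hw.aestronglyMeasurable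
  set S : ℝ≥0∞ := eLpNorm (v + w) (P * 2) volume with hS
  set D : ℝ≥0∞ := eLpNorm (v - w) (P * 2) volume with hD
  have ht' : ‖t‖ₑ = ENNReal.ofReal t := Real.enorm_eq_ofReal ht.le
  have hti : ‖t⁻¹‖ₑ = ENNReal.ofReal t⁻¹ := Real.enorm_eq_ofReal (inv_nonneg.2 ht.le)
  have hNp : eLpNorm fp (P * 2) volume ≤ ENNReal.ofReal t * S + ENNReal.ofReal t⁻¹ * D := by
    calc eLpNorm fp (P * 2) volume
        ≤ eLpNorm (t • (v + w)) (P * 2) volume + eLpNorm (t⁻¹ • (v - w)) (P * 2) volume :=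
          eLpNorm_add_le ((hvm.add hwm).const_smul t) ((hvm.sub hwm).const_smul t⁻¹) hP21
      _ = ENNReal.ofReal t * S + ENNReal.ofReal t⁻¹ * D := by
          rw [eLpNorm_const_smul, eLpNorm_const_smul, ht', hti]
  have hNm : eLpNorm fm (P * 2) volume ≤ ENNReal.ofReal t * S + ENNReal.ofReal t⁻¹ * D := by
    calc eLpNorm fm (P * 2) volume
        ≤ eLpNorm (t • (v + w)) (P * 2) volume + eLpNorm (t⁻¹ • (v - w)) (P * 2) volume :=
          eLpNorm_sub_le ((hvm.add hwm).const_smul t) ((hvm.sub hwm).const_smul t⁻¹) hP21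
      _ = ENNReal.ofReal t * S + ENNReal.ofReal t⁻¹ * D := by
          rw [eLpNorm_const_smul, eLpNorm_const_smul, ht', hti]
  -- `‖|f|²‖_P = ‖f‖²_{2P}`
  have hsq : ∀ f : ℝ³ → ℝ³, eLpNorm (fun y => ‖f y‖ ^ 2) P volume = eLpNorm f (P * 2) volume ^ 2 := by
    intro f
    have h := eLpNorm_norm_rpow f (p := P) (μ := volume) zero_lt_two
    simp only [Real.rpow_two, ENNReal.rpow_two, ENNReal.ofReal_ofNat] at h
    exact h
  -- the bound `(tS + t⁻¹D)² ≤ 2t²S² + 2t⁻²D²`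
  have hsq2 : (ENNReal.ofReal t * S + ENNReal.ofReal t⁻¹ * D) ^ 2 ≤
      ENNReal.ofReal (t ^ 2) * (2 * S ^ 2) + ENNReal.ofReal (t⁻¹ ^ 2) * (2 * D ^ 2) := by
    refine (PoincareBall.add_sq_le_two_mul_sq_add _ _).trans (le_of_eq ?_)
    rw [mul_pow, mul_pow, ENNReal.ofReal_pow ht.le, ENNReal.ofReal_pow (inv_nonneg.2 ht.le)]
    ring
  calc eLpNorm (fun x => regPressure ε v x - regPressure ε w x) P volume
      = ‖(4⁻¹ : ℝ)‖ₑ * eLpNorm (fun x => regPressure ε fp x - regPressure ε fm x) P volume := by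
        rw [hfun, eLpNorm_const_smul]
    _ ≤ ‖(4⁻¹ : ℝ)‖ₑ * (eLpNorm (regPressure ε fp) P volume + eLpNorm (regPressure ε fm) P volume) := by
        gcongr
        exact eLpNorm_sub_le hmp hmm hP1
    _ ≤ ‖(4⁻¹ : ℝ)‖ₑ * (C * eLpNorm (fun y => ‖fp y‖ ^ 2) P volume +
          C * eLpNorm (fun y => ‖fm y‖ ^ 2) P volume) := by
        gcongr
        · exact hC fp hfp hfpc
        · exact hC fm hfm hfmc
    _ = ‖(4⁻¹ : ℝ)‖ₑ * C * (eLpNorm fp (P * 2) volume ^ 2 + eLpNorm fm (P * 2) volume ^ 2) := by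
        rw [hsq, hsq]
        ring
    _ ≤ ‖(4⁻¹ : ℝ)‖ₑ * C * ((ENNReal.ofReal t * S + ENNReal.ofReal t⁻¹ * D) ^ 2 +
          (ENNReal.ofReal t * S + ENNReal.ofReal t⁻¹ * D) ^ 2) := by
        gcongr
    _ ≤ ‖(4⁻¹ : ℝ)‖ₑ * C * (2 * (ENNReal.ofReal (t ^ 2) * (2 * S ^ 2) +
          ENNReal.ofReal (t⁻¹ ^ 2) * (2 * D ^ 2))) := by
        rw [← two_mul]
        gcongr
    _ ≤ C * (ENNReal.ofReal (t ^ 2) * (2 * S ^ 2) + ENNReal.ofReal (t⁻¹ ^ 2) * (2 * D ^ 2)) := by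
        have h4 : ‖(4⁻¹ : ℝ)‖ₑ * 2 ≤ 1 := by
          rw [Real.enorm_eq_ofReal (by norm_num : (0 : ℝ) ≤ 4⁻¹), ← ENNReal.ofReal_ofNat,
            ← ENNReal.ofReal_mul (by norm_num), ← ENNReal.ofReal_one]
          exact ENNReal.ofReal_le_ofReal (by norm_num)
        calc ‖(4⁻¹ : ℝ)‖ₑ * C * (2 * (ENNReal.ofReal (t ^ 2) * (2 * S ^ 2) +
              ENNReal.ofReal (t⁻¹ ^ 2) * (2 * D ^ 2)))
            = (‖(4⁻¹ : ℝ)‖ₑ * 2) * (C * (ENNReal.ofReal (t ^ 2) * (2 * S ^ 2) +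
              ENNReal.ofReal (t⁻¹ ^ 2) * (2 * D ^ 2))) := by ring
          _ ≤ 1 * (C * (ENNReal.ofReal (t ^ 2) * (2 * S ^ 2) +
              ENNReal.ofReal (t⁻¹ ^ 2) * (2 * D ^ 2))) := by gcongr
          _ = _ := one_mul _

end Regularised

/-! ## §2. Passage to the normalised pressure (Fatou) -/

section Fatou

variable {v w : ℝ³ → ℝ³}

/-- **`L^P` bound for the normalised pressure with the constant of the regularised bound**
(the three-line Fatou argument of `stein1970_normalisedPressure_Lp_bound_holds`, recorded for a
given constant `C`). [cite: Stein1971, Ch. II §4.2 Thm 3] -/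
theorem eLpNorm_normalisedPressure_le_of_reg {P : ℝ≥0∞} {C : ℝ≥0}
    (hC : ∀ ε : ℝ, 0 < ε → ∀ w : ℝ³ → ℝ³, Continuous w → HasCompactSupport w →
      eLpNorm (regPressure ε w) P volume ≤ C * eLpNorm (fun y => ‖w y‖ ^ 2) P volume)
    (hw : ContDiff ℝ ∞ w) (hwc : HasCompactSupport w) :
    eLpNorm (normalisedPressure w) P volume ≤ C * eLpNorm (fun y => ‖w y‖ ^ 2) P volume := by
  have hfun : normalisedPressure w = limPressure w := funext (normalisedPressure_eq_limPressure hw hwc)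
  rw [hfun]
  have hFatou := Lp.eLpNorm_lim_le_liminf_eLpNorm (μ := volume) (p := P)
    (f := fun n : ℕ => regPressure (1 / ((n : ℝ) + 1)) w)
    (fun n => aestronglyMeasurable_regPressure (1 / ((n : ℝ) + 1)) hw.continuous hwc)
    (limPressure w) (Eventually.of_forall fun x => tendsto_regPressure_nat hw hwc x)
  refine hFatou.trans (liminf_le_of_frequently_le' (Eventually.of_forall fun n => ?_).frequently)
  exact hC _ (one_div_pos.2 (Nat.cast_add_one_pos n)) w hw.continuous hwc

/-- **The bound for differences of normalised pressures** (Fatou on the regularised bound):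
for `v, w ∈ C_c^∞(ℝ³; ℝ³)` and every `t > 0`,
`‖p̃[v] − p̃[w]‖_P ≤ C (2t² ‖v + w‖²_{2P} + 2t⁻² ‖v − w‖²_{2P})`. [folklore] -/
theorem eLpNorm_normalisedPressure_sub_le_of_reg {P : ℝ≥0∞} (hP1 : 1 ≤ P) {C : ℝ≥0}
    (hC : ∀ ε : ℝ, 0 < ε → ∀ w : ℝ³ → ℝ³, Continuous w → HasCompactSupport w →
      eLpNorm (regPressure ε w) P volume ≤ C * eLpNorm (fun y => ‖w y‖ ^ 2) P volume)
    (hv : ContDiff ℝ ∞ v) (hvc : HasCompactSupport v) (hw : ContDiff ℝ ∞ w)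
    (hwc : HasCompactSupport w) {t : ℝ} (ht : 0 < t) :
    eLpNorm (fun x => normalisedPressure v x - normalisedPressure w x) P volume ≤
      C * (ENNReal.ofReal (t ^ 2) * (2 * eLpNorm (v + w) (P * 2) volume ^ 2) +
        ENNReal.ofReal (t⁻¹ ^ 2) * (2 * eLpNorm (v - w) (P * 2) volume ^ 2)) := by
  have hfun : (fun x => normalisedPressure v x - normalisedPressure w x) =
      fun x => limPressure v x - limPressure w x := by
    funext x
    rw [normalisedPressure_eq_limPressure hv hvc, normalisedPressure_eq_limPressure hw hwc]
  rw [hfun]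
  have hFatou := Lp.eLpNorm_lim_le_liminf_eLpNorm (μ := volume) (p := P)
    (f := fun n : ℕ => fun x => regPressure (1 / ((n : ℝ) + 1)) v x - regPressure (1 / ((n : ℝ) + 1)) w x)
    (fun n => (aestronglyMeasurable_regPressure (1 / ((n : ℝ) + 1)) hv.continuous hvc).sub
      (aestronglyMeasurable_regPressure (1 / ((n : ℝ) + 1)) hw.continuous hwc))
    (fun x => limPressure v x - limPressure w x)
    (Eventually.of_forall fun x =>
      (tendsto_regPressure_nat hv hvc x).sub (tendsto_regPressure_nat hw hwc x))
  refine hFatou.trans (liminf_le_of_frequently_le' (Eventually.of_forall fun n => ?_).frequently)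
  exact eLpNorm_regPressure_sub_le hP1 (hC _ (one_div_pos.2 (Nat.cast_add_one_pos n)))
    hv.continuous hvc hw.continuous hwc ht

end Fatou

/-! ## §3. Exponent bookkeeping and two convergence lemmas -/

section Exponents

/-- `‖|f|²‖_P = ‖f‖²_{2P}`. [folklore] -/
theorem eLpNorm_norm_sq_eq_mul_two (f : ℝ³ → ℝ³) (P : ℝ≥0∞) :
    eLpNorm (fun y => ‖f y‖ ^ 2) P volume = eLpNorm f (P * 2) volume ^ 2 := by
  have h := eLpNorm_norm_rpow f (p := P) (μ := volume) zero_lt_two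
  simp only [Real.rpow_two, ENNReal.rpow_two, ENNReal.ofReal_ofNat] at h
  exact h

/-- The Hölder triple `(2P)⁻¹ + (2P)⁻¹ = P⁻¹`. [folklore] -/
theorem holderTriple_mul_two (P : ℝ≥0∞) : ENNReal.HolderTriple (P * 2) (P * 2) P := by
  refine ⟨?_⟩
  rw [ENNReal.mul_inv (Or.inr ENNReal.ofNat_ne_top) (Or.inr two_ne_zero), ← mul_add,
    ENNReal.inv_two_add_inv_two, mul_one]

/-- The Hölder triple `q⁻¹ + (q/(q-1))⁻¹ = 1` for `1 < q`. [folklore] -/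
theorem holderTriple_conj {q : ℝ} (hq : 1 < q) :
    ENNReal.HolderTriple (ENNReal.ofReal q) (ENNReal.ofReal (q / (q - 1))) 1 := by
  refine ⟨?_⟩
  have hq0 : 0 < q := by linarith
  have hq1 : 0 < q - 1 := by linarith
  have hq' : 0 < q / (q - 1) := by positivity
  rw [inv_one, ← ENNReal.ofReal_inv_of_pos hq0, ← ENNReal.ofReal_inv_of_pos hq',
    ← ENNReal.ofReal_add (by positivity) (by positivity), ← ENNReal.ofReal_one]
  congr 1
  field_simp
  ring

/-- **Pairings against a fixed `L^{Q'}` function are continuous for `L^P` convergence**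
(Hölder at exponent one): if `‖gₙ‖_P → 0` and `ψ ∈ L^{Q'}`, `P⁻¹ + Q'⁻¹ = 1`, then
`∫ gₙ ψ → 0`. [folklore] -/
theorem tendsto_integral_mul_of_eLpNorm_tendsto_zero {P Q' : ℝ≥0∞} [ENNReal.HolderTriple P Q' 1]
    {g : ℕ → ℝ³ → ℝ} {ψ : ℝ³ → ℝ} (hg : ∀ n, AEStronglyMeasurable (g n) volume)
    (hψ : MemLp ψ Q' volume) (hlim : Tendsto (fun n => eLpNorm (g n) P volume) atTop (𝓝 0)) :
    Tendsto (fun n => ∫ y, g n y * ψ y) atTop (𝓝 0) := by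
  have hψtop : eLpNorm ψ Q' volume ≠ ⊤ := hψ.eLpNorm_ne_top
  -- Hölder at exponent `1`
  have hH : ∀ n, eLpNorm (fun y => g n y * ψ y) 1 volume ≤ eLpNorm (g n) P volume * eLpNorm ψ Q' volume := by
    intro n
    have h := eLpNorm_le_eLpNorm_mul_eLpNorm_of_nnnorm (hg n) hψ.1 (· * ·) 1
      (Eventually.of_forall fun y => by simp [nnnorm_mul]) (p := P) (q := Q') (r := 1)
    simpa using h
  -- the product tends to `0`
  have hprod : Tendsto (fun n => eLpNorm (g n) P volume * eLpNorm ψ Q' volume) atTop (𝓝 0) := by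
    have h := ENNReal.Tendsto.mul_const hlim (Or.inr hψtop)
    rwa [zero_mul] at h
  have h1 : Tendsto (fun n => eLpNorm (fun y => g n y * ψ y) 1 volume) atTop (𝓝 0) :=
    tendsto_of_tendsto_of_tendsto_of_le_of_le tendsto_const_nhds hprod (fun _ => zero_le) hH
  have h2 : Tendsto (fun n => (eLpNorm (fun y => g n y * ψ y) 1 volume).toReal) atTop (𝓝 0) := by
    have h := (ENNReal.tendsto_toReal ENNReal.zero_ne_top).comp h1
    rwa [ENNReal.toReal_zero] at h
  refine squeeze_zero_norm (fun n => ?_) h2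
  rw [eLpNorm_one_eq_lintegral_enorm]
  have h := norm_integral_le_lintegral_norm (μ := volume) (fun y => g n y * ψ y)
  simp_rw [ofReal_norm] at h
  exact h

end Exponents

/-! ## §4. The Riesz pressure of an `L^{2q}` field -/

section Main

/-- **Continuity of `w ↦ ∫ D²φ(w, w)` for `L^{2q}` convergence** against a test function `φ`:
if `wₙ → U` in `L^{2q}` then `∫ D²φ(wₙ, wₙ) → ∫ D²φ(U, U)` (`|D²φ(a,a) − D²φ(b,b)| ≤
‖D²φ‖ |a − b| (|a| + |b|)`, Hölder twice: exponents `(q', q)` and `(2q, 2q)`). [folklore] -/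
theorem tendsto_integral_hessian_apply_of_eLpNorm {q : ℝ} (hq : 1 < q) {U : ℝ³ → ℝ³}
    (hU : MemLp U (ENNReal.ofReal q * 2) volume) {w : ℕ → ℝ³ → ℝ³}
    (hw : ∀ n, MemLp (w n) (ENNReal.ofReal q * 2) volume) {M : ℝ≥0∞} (hM : M ≠ ⊤)
    (hwM : ∀ n, eLpNorm (w n) (ENNReal.ofReal q * 2) volume ≤ M)
    (hlim : Tendsto (fun n => eLpNorm (w n - U) (ENNReal.ofReal q * 2) volume) atTop (𝓝 0))
    {φ : ℝ³ → ℝ} (hφ : ContDiff ℝ 2 φ) (hφc : HasCompactSupport φ) :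
    Tendsto (fun n => ∫ y, fderiv ℝ (fderiv ℝ φ) y (w n y) (w n y)) atTop
      (𝓝 (∫ y, fderiv ℝ (fderiv ℝ φ) y (U y) (U y))) := by
  have hq0 : 0 < q := by linarith
  set P : ℝ≥0∞ := ENNReal.ofReal q with hPdef
  set Q' : ℝ≥0∞ := ENNReal.ofReal (q / (q - 1)) with hQ'def
  haveI hT1 : ENNReal.HolderTriple P Q' 1 := holderTriple_conj hq
  haveI hT2 : ENNReal.HolderTriple (P * 2) (P * 2) P := holderTriple_mul_two P
  have hP1 : 1 ≤ P := by
    rw [hPdef, ← ENNReal.ofReal_one]; exact ENNReal.ofReal_le_ofReal hq.le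
  have hP21 : 1 ≤ P * 2 := hP1.trans (le_mul_of_one_le_right zero_le one_le_two)
  -- the Hessian field and its norm
  set G : ℝ³ → ℝ³ →L[ℝ] ℝ³ →L[ℝ] ℝ := fun y => fderiv ℝ (fderiv ℝ φ) y with hGdef
  have hG : Continuous G := (hφ.fderiv_right (m := 1) (by norm_cast)).continuous_fderiv one_ne_zero
  have hGc : HasCompactSupport G := (hφc.fderiv (𝕜 := ℝ)).fderiv (𝕜 := ℝ)
  have hGn : Continuous fun y => ‖G y‖ := hG.norm
  have hGnc : HasCompactSupport fun y => ‖G y‖ := hGc.norm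
  have hGnLp : MemLp (fun y => ‖G y‖) Q' volume := hGn.memLp_of_hasCompactSupport hGnc
  -- measurability
  have hUm := hU.aestronglyMeasurable
  have hwm : ∀ n, AEStronglyMeasurable (w n) volume := fun n => (hw n).aestronglyMeasurable
  have hΨ : Continuous fun p : (ℝ³ →L[ℝ] ℝ³ →L[ℝ] ℝ) × ℝ³ => p.1 p.2 p.2 :=
    (continuous_fst.clm_apply continuous_snd).clm_apply continuous_snd
  have hmeasUU : AEStronglyMeasurable (fun y => G y (U y) (U y)) volume :=
    hΨ.comp_aestronglyMeasurable (hG.aestronglyMeasurable.prodMk hUm)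
  have hmeasww : ∀ n, AEStronglyMeasurable (fun y => G y (w n y) (w n y)) volume := fun n =>
    hΨ.comp_aestronglyMeasurable (hG.aestronglyMeasurable.prodMk (hwm n))
  -- integrability of `D²φ(V, V)` for `V ∈ L^{2P}`
  have hint : ∀ {V : ℝ³ → ℝ³}, MemLp V (P * 2) volume →
      AEStronglyMeasurable (fun y => G y (V y) (V y)) volume →
      Integrable (fun y => G y (V y) (V y)) := by
    intro V hV hVm
    have hV2 : MemLp (fun y => ‖V y‖ ^ 2) P volume := by
      refine ⟨hV.1.norm.pow 2, ?_⟩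
      rw [eLpNorm_norm_sq_eq_mul_two]
      exact ENNReal.pow_lt_top hV.eLpNorm_lt_top
    have hloc : LocallyIntegrable (fun y => ‖V y‖ ^ 2) volume := hV2.locallyIntegrable hP1
    have hdom : Integrable (fun y => ‖V y‖ ^ 2 * ‖G y‖) := by
      simpa only [smul_eq_mul] using hloc.integrable_smul_right_of_hasCompactSupport hGn hGnc
    refine hdom.mono' hVm (Eventually.of_forall fun y => ?_)
    calc ‖G y (V y) (V y)‖ ≤ ‖G y‖ * ‖V y‖ * ‖V y‖ := (G y).le_opNorm₂ (V y) (V y)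
      _ = ‖V y‖ ^ 2 * ‖G y‖ := by ring
  have hIU := hint hU hmeasUU
  have hIw : ∀ n, Integrable (fun y => G y (w n y) (w n y)) := fun n => hint (hw n) (hmeasww n)
  -- the difference `hₙ = D²φ(wₙ,wₙ) − D²φ(U,U)` in `L¹`
  have hbound : ∀ n, eLpNorm (fun y => G y (w n y) (w n y) - G y (U y) (U y)) 1 volume ≤
      eLpNorm (fun y => ‖G y‖) Q' volume *
        (eLpNorm (w n - U) (P * 2) volume * (M + eLpNorm U (P * 2) volume)) := by
    intro n
    -- pointwise bound
    have hpt : ∀ y, ‖G y (w n y) (w n y) - G y (U y) (U y)‖ ≤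
        ‖G y‖ * (‖w n y - U y‖ * (‖w n y‖ + ‖U y‖)) := by
      intro y
      have e : G y (w n y) (w n y) - G y (U y) (U y) =
          G y (w n y - U y) (w n y) + G y (U y) (w n y - U y) := by
        simp only [map_sub, _root_.sub_apply]
        ring
      rw [e]
      calc ‖G y (w n y - U y) (w n y) + G y (U y) (w n y - U y)‖
          ≤ ‖G y (w n y - U y) (w n y)‖ + ‖G y (U y) (w n y - U y)‖ := norm_add_le _ _
        _ ≤ ‖G y‖ * ‖w n y - U y‖ * ‖w n y‖ + ‖G y‖ * ‖U y‖ * ‖w n y - U y‖ :=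
            add_le_add ((G y).le_opNorm₂ _ _) ((G y).le_opNorm₂ _ _)
        _ = ‖G y‖ * (‖w n y - U y‖ * (‖w n y‖ + ‖U y‖)) := by ring
    -- step 1: domination
    have h1 : eLpNorm (fun y => G y (w n y) (w n y) - G y (U y) (U y)) 1 volume ≤
        eLpNorm (fun y => ‖G y‖ * (‖w n y - U y‖ * (‖w n y‖ + ‖U y‖))) 1 volume :=
      eLpNorm_mono fun y => (hpt y).trans (le_of_eq (Real.norm_of_nonneg (by positivity)).symm)
    -- step 2: Hölder `(Q', P)`
    have hkm : AEStronglyMeasurable (fun y => ‖w n y - U y‖ * (‖w n y‖ + ‖U y‖)) volume :=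
      ((hwm n).sub hUm).norm.mul ((hwm n).norm.add hUm.norm)
    have h2 : eLpNorm (fun y => ‖G y‖ * (‖w n y - U y‖ * (‖w n y‖ + ‖U y‖))) 1 volume ≤
        eLpNorm (fun y => ‖G y‖) Q' volume *
          eLpNorm (fun y => ‖w n y - U y‖ * (‖w n y‖ + ‖U y‖)) P volume := by
      have h := eLpNorm_le_eLpNorm_mul_eLpNorm_of_nnnorm hGn.aestronglyMeasurable hkm (· * ·) 1
        (Eventually.of_forall fun y => by simp [nnnorm_mul]) (p := Q') (q := P) (r := 1)
      simpa using h
    -- step 3: Hölder `(2P, 2P)`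
    have h3 : eLpNorm (fun y => ‖w n y - U y‖ * (‖w n y‖ + ‖U y‖)) P volume ≤
        eLpNorm (fun y => w n y - U y) (P * 2) volume *
          eLpNorm ((fun y => ‖w n y‖) + fun y => ‖U y‖) (P * 2) volume := by
      have h := eLpNorm_le_eLpNorm_mul_eLpNorm_of_nnnorm ((hwm n).sub hUm).norm
        ((hwm n).norm.add hUm.norm) (· * ·) 1
        (Eventually.of_forall fun y => by simp [nnnorm_mul]) (p := P * 2) (q := P * 2) (r := P)
      simpa using h
    -- step 4: the two factors
    have h4 : eLpNorm (fun y => w n y - U y) (P * 2) volume = eLpNorm (w n - U) (P * 2) volume := rfl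
    have h5 : eLpNorm ((fun y => ‖w n y‖) + fun y => ‖U y‖) (P * 2) volume ≤
        M + eLpNorm U (P * 2) volume := by
      calc eLpNorm ((fun y => ‖w n y‖) + fun y => ‖U y‖) (P * 2) volume
          ≤ eLpNorm (fun y => ‖w n y‖) (P * 2) volume + eLpNorm (fun y => ‖U y‖) (P * 2) volume :=
            eLpNorm_add_le (hwm n).norm hUm.norm hP21
        _ = eLpNorm (w n) (P * 2) volume + eLpNorm U (P * 2) volume := by
            rw [eLpNorm_norm (w n), eLpNorm_norm U]
        _ ≤ M + eLpNorm U (P * 2) volume := add_le_add (hwM n) le_rfl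
    calc _ ≤ _ := h1
      _ ≤ _ := h2
      _ ≤ eLpNorm (fun y => ‖G y‖) Q' volume *
          (eLpNorm (fun y => w n y - U y) (P * 2) volume *
            eLpNorm ((fun y => ‖w n y‖) + fun y => ‖U y‖) (P * 2) volume) := by gcongr
      _ ≤ _ := by rw [h4]; gcongr
  -- the bound tends to `0`
  have hGtop : eLpNorm (fun y => ‖G y‖) Q' volume ≠ ⊤ := hGnLp.eLpNorm_ne_top
  have hMU : M + eLpNorm U (P * 2) volume ≠ ⊤ := ENNReal.add_ne_top.2 ⟨hM, hU.eLpNorm_ne_top⟩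
  have hT : Tendsto (fun n => eLpNorm (fun y => ‖G y‖) Q' volume *
      (eLpNorm (w n - U) (P * 2) volume * (M + eLpNorm U (P * 2) volume))) atTop (𝓝 0) := by
    have h1 := ENNReal.Tendsto.mul_const hlim (Or.inr hMU)
    rw [zero_mul] at h1
    have h2 := ENNReal.Tendsto.const_mul h1 (Or.inr hGtop)
    rwa [mul_zero] at h2
  have hL1 : Tendsto (fun n => eLpNorm (fun y => G y (w n y) (w n y) - G y (U y) (U y)) 1 volume)
      atTop (𝓝 0) :=
    tendsto_of_tendsto_of_tendsto_of_le_of_le tendsto_const_nhds hT (fun _ => zero_le) hbound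
  have hL1' : Tendsto (fun n => (eLpNorm (fun y => G y (w n y) (w n y) - G y (U y) (U y)) 1
      volume).toReal) atTop (𝓝 0) := by
    have h := (ENNReal.tendsto_toReal ENNReal.zero_ne_top).comp hL1
    rwa [ENNReal.toReal_zero] at h
  -- conclude
  rw [← tendsto_sub_nhds_zero_iff]
  refine squeeze_zero_norm (fun n => ?_) hL1'
  rw [← integral_sub (hIw n) hIU, eLpNorm_one_eq_lintegral_enorm]
  have h := norm_integral_le_lintegral_norm (μ := volume)
    (fun y => G y (w n y) (w n y) - G y (U y) (U y))
  simp_rw [ofReal_norm] at h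
  exact h

/-- **The Riesz pressure of an `L^{2q}` field** (NRŠ 1996, §2 p. 285: "If `U ∈ L^{2q}(ℝⁿ)` for
some `q > 1`, we can use the classical Riesz transformation to solve (2.2)"; Tsai 1998, proof of
Lemma 2.1, p. 34: "(2.5) can be established for `U ∈ C_c^∞ ⊂ L²`. We then extend this result to
general `U ∈ L^q` by approximation"). For `1 < q < ∞` there is `C` such that every
`U ∈ L^{2q}(ℝ³; ℝ³)` admits `Q ∈ L^q` with `‖Q‖_q ≤ C ‖U‖²_{2q}` and
`∫ Q Δφ = −∫ D²φ(U, U)` for all `φ ∈ C_c^∞(ℝ³)`. Proof: module docstring, §4 (approximation by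
test fields, the Cauchy estimate from the polarisation bound, completeness of `L^q`, and the two
Hölder limits). [cite: NecasRuzickaSverak1996, §2 p. 285 (with [CZ], [St])] -/
theorem exists_rieszPressure {q : ℝ} (hq : 1 < q) :
    ∃ C : ℝ≥0, ∀ U : ℝ³ → ℝ³, MemLp U (ENNReal.ofReal q * 2) volume →
      ∃ Q : ℝ³ → ℝ, MemLp Q (ENNReal.ofReal q) volume ∧
        eLpNorm Q (ENNReal.ofReal q) volume ≤ C * eLpNorm U (ENNReal.ofReal q * 2) volume ^ 2 ∧
        ∀ φ : ℝ³ → ℝ, ContDiff ℝ (⊤ : ℕ∞) φ → HasCompactSupport φ →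
          ∫ y, Q y * (Δ φ) y = -∫ y, fderiv ℝ (fderiv ℝ φ) y (U y) (U y) := by
  have hq0 : 0 < q := by linarith
  set P : ℝ≥0∞ := ENNReal.ofReal q with hPdef
  have hP1 : 1 < P := by
    rw [hPdef, ← ENNReal.ofReal_one]; exact (ENNReal.ofReal_lt_ofReal_iff hq0).2 hq
  have hP1' : 1 ≤ P := hP1.le
  have hPtop : P < ⊤ := ENNReal.ofReal_lt_top
  have hP21 : 1 ≤ P * 2 := hP1'.trans (le_mul_of_one_le_right zero_le one_le_two)
  have hP2top : P * 2 ≠ ⊤ := ENNReal.mul_ne_top hPtop.ne ENNReal.ofNat_ne_top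
  obtain ⟨C, hC⟩ := exists_eLpNorm_regPressure_le hP1 hPtop
  refine ⟨C, fun U hU => ?_⟩
  have hUm := hU.aestronglyMeasurable
  set NU : ℝ≥0∞ := eLpNorm U (P * 2) volume with hNUdef
  have hNUtop : NU ≠ ⊤ := hU.eLpNorm_ne_top
  -- ## approximation by test fields: `‖U - wₙ‖_{2P} ≤ 2⁻ⁿ`
  have happrox : ∀ n : ℕ, ∃ w : ℝ³ → ℝ³, HasCompactSupport w ∧ ContDiff ℝ ∞ w ∧
      eLpNorm (U - w) (P * 2) volume ≤ ENNReal.ofReal ((1 / 2 : ℝ) ^ n) :=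
    fun n => hU.exist_eLpNorm_sub_le hP2top hP21 (by positivity)
  choose w hwc hws hwU using happrox
  set δ : ℕ → ℝ≥0∞ := fun n => (2⁻¹ : ℝ≥0∞) ^ n with hδdef
  have hδof : ∀ n : ℕ, ENNReal.ofReal ((1 / 2 : ℝ) ^ n) = δ n := fun n => by
    rw [hδdef, ENNReal.ofReal_pow (by norm_num), one_div, ENNReal.ofReal_inv_of_pos two_pos,
      ENNReal.ofReal_ofNat]
  have hwU' : ∀ n, eLpNorm (U - w n) (P * 2) volume ≤ δ n := fun n => (hwU n).trans_eq (hδof n)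
  have hδle : ∀ n, δ n ≤ 1 := fun n => pow_le_one₀ zero_le (ENNReal.inv_le_one.2 one_le_two)
  have hδmono : ∀ {N n : ℕ}, N ≤ n → δ n ≤ δ N := fun h =>
    pow_le_pow_right_of_le_one' (ENNReal.inv_le_one.2 one_le_two) h
  have hδ0 : ∀ n, δ n ≠ 0 := fun n => pow_ne_zero _ (ENNReal.inv_ne_zero.2 ENNReal.ofNat_ne_top)
  have hδtop : ∀ n, δ n ≠ ⊤ := fun n => ENNReal.pow_ne_top (ENNReal.inv_ne_top.2 two_ne_zero)
  have hδlim : Tendsto δ atTop (𝓝 0) :=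
    ENNReal.tendsto_pow_atTop_nhds_zero_of_lt_one (ENNReal.inv_lt_one.2 ENNReal.one_lt_two)
  have h2δ : ∀ n : ℕ, (2 : ℝ≥0∞) ^ n * δ n = 1 := fun n => by
    rw [hδdef, ← mul_pow, ENNReal.mul_inv_cancel two_ne_zero ENNReal.ofNat_ne_top, one_pow]
  -- ## norms of the approximants
  have hwm : ∀ n, AEStronglyMeasurable (w n) volume := fun n =>
    (hws n).continuous.aestronglyMeasurable
  have hwLp : ∀ n, MemLp (w n) (P * 2) volume := fun n =>
    (hws n).continuous.memLp_of_hasCompactSupport (hwc n)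
  have hwN : ∀ n, eLpNorm (w n) (P * 2) volume ≤ NU + δ n := fun n => by
    calc eLpNorm (w n) (P * 2) volume = eLpNorm (U - (U - w n)) (P * 2) volume := by
          rw [sub_sub_cancel]
      _ ≤ eLpNorm U (P * 2) volume + eLpNorm (U - w n) (P * 2) volume :=
          eLpNorm_sub_le hUm (hUm.sub (hwm n)) hP21
      _ ≤ NU + δ n := add_le_add le_rfl (hwU' n)
  have hwN1 : ∀ n, eLpNorm (w n) (P * 2) volume ≤ NU + 1 := fun n =>
    (hwN n).trans (add_le_add le_rfl (hδle n))
  have hwdiff : ∀ {N n m : ℕ}, N ≤ n → N ≤ m → eLpNorm (w n - w m) (P * 2) volume ≤ 2 * δ N := by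
    intro N n m hn hm
    calc eLpNorm (w n - w m) (P * 2) volume
        = eLpNorm ((w n - U) + (U - w m)) (P * 2) volume := by rw [sub_add_sub_cancel]
      _ ≤ eLpNorm (w n - U) (P * 2) volume + eLpNorm (U - w m) (P * 2) volume :=
          eLpNorm_add_le ((hwm n).sub hUm) (hUm.sub (hwm m)) hP21
      _ ≤ δ n + δ m := add_le_add (by rw [eLpNorm_sub_comm]; exact hwU' n) (hwU' m)
      _ ≤ δ N + δ N := add_le_add (hδmono hn) (hδmono hm)
      _ = 2 * δ N := (two_mul _).symm
  have hwsum : ∀ n m, eLpNorm (w n + w m) (P * 2) volume ≤ 2 * (NU + 1) := fun n m =>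
    (eLpNorm_add_le (hwm n) (hwm m) hP21).trans
      ((add_le_add (hwN1 n) (hwN1 m)).trans (two_mul _).symm.le)
  -- ## the pressures of the approximants form a Cauchy sequence in `L^P`
  set f : ℕ → ℝ³ → ℝ := fun n => normalisedPressure (w n) with hfdef
  have hfP : ∀ n, MemLp (f n) P volume := fun n =>
    memLp_normalisedPressure_of_hasCompactSupport (hws n) (hwc n) hq
  set K₁ : ℝ≥0∞ := C * (2 * (2 * (NU + 1)) ^ 2 + 8) with hK₁def
  have hK₁top : K₁ ≠ ⊤ := by
    refine ENNReal.mul_ne_top ENNReal.coe_ne_top (ENNReal.add_ne_top.2 ⟨?_, by norm_num⟩)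
    exact ENNReal.mul_ne_top (by norm_num) (ENNReal.pow_ne_top
      (ENNReal.mul_ne_top (by norm_num) (ENNReal.add_ne_top.2 ⟨hNUtop, ENNReal.one_ne_top⟩)))
  have hcau_le : ∀ N n m, N ≤ n → N ≤ m → eLpNorm (f n - f m) P volume ≤ K₁ * δ N := by
    intro N n m hn hm
    set t : ℝ := Real.sqrt ((1 / 2 : ℝ) ^ N) with htdef
    have hhalf : (0 : ℝ) < (1 / 2 : ℝ) ^ N := by positivity
    have ht : 0 < t := Real.sqrt_pos.2 hhalf
    have ht2 : t ^ 2 = (1 / 2 : ℝ) ^ N := Real.sq_sqrt hhalf.le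
    have hti2 : t⁻¹ ^ 2 = (2 : ℝ) ^ N := by rw [inv_pow, ht2, one_div, inv_pow, inv_inv]
    have e1 : ENNReal.ofReal (t ^ 2) = δ N := by rw [ht2, hδof]
    have e2 : ENNReal.ofReal (t⁻¹ ^ 2) = 2 ^ N := by
      rw [hti2, ENNReal.ofReal_pow zero_le_two, ENNReal.ofReal_ofNat]
    have key := eLpNorm_normalisedPressure_sub_le_of_reg hP1' hC (hws n) (hwc n) (hws m) (hwc m) ht
    rw [e1, e2] at key
    refine key.trans ?_
    calc C * (δ N * (2 * eLpNorm (w n + w m) (P * 2) volume ^ 2) +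
          2 ^ N * (2 * eLpNorm (w n - w m) (P * 2) volume ^ 2))
        ≤ C * (δ N * (2 * (2 * (NU + 1)) ^ 2) + 2 ^ N * (2 * (2 * δ N) ^ 2)) := by
          gcongr
          · exact hwsum n m
          · exact hwdiff hn hm
      _ = C * (δ N * (2 * (2 * (NU + 1)) ^ 2) + 8 * δ N * (2 ^ N * δ N)) := by ring
      _ = K₁ * δ N := by rw [h2δ, hK₁def]; ring
  set B : ℕ → ℝ≥0∞ := fun N => (K₁ + 1) * δ N with hBdef
  have hB : ∑' N, B N ≠ ⊤ := by
    rw [hBdef, ENNReal.tsum_mul_left, hδdef, ENNReal.tsum_geometric, ENNReal.one_sub_inv_two,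
      inv_inv]
    exact ENNReal.mul_ne_top (ENNReal.add_ne_top.2 ⟨hK₁top, ENNReal.one_ne_top⟩) ENNReal.ofNat_ne_top
  have hcau : ∀ N n m : ℕ, N ≤ n → N ≤ m → eLpNorm (f n - f m) P volume < B N := by
    intro N n m hn hm
    refine (hcau_le N n m hn hm).trans_lt ?_
    rw [hBdef]
    exact ENNReal.mul_lt_mul_left (hδ0 N) (hδtop N) (ENNReal.lt_add_right hK₁top one_ne_zero)
  obtain ⟨Q, hQ, hlim⟩ := Lp.cauchy_complete_eLpNorm (μ := volume) hP1' hfP hB hcau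
  refine ⟨Q, hQ, ?_, ?_⟩
  · -- ## the norm bound
    have hle : ∀ n, eLpNorm Q P volume ≤ eLpNorm (f n - Q) P volume + C * (NU + δ n) ^ 2 := by
      intro n
      calc eLpNorm Q P volume = eLpNorm (f n - (f n - Q)) P volume := by rw [sub_sub_cancel]
        _ ≤ eLpNorm (f n) P volume + eLpNorm (f n - Q) P volume :=
            eLpNorm_sub_le (hfP n).1 ((hfP n).1.sub hQ.1) hP1'
        _ ≤ C * eLpNorm (fun y => ‖w n y‖ ^ 2) P volume + eLpNorm (f n - Q) P volume :=
            add_le_add (eLpNorm_normalisedPressure_le_of_reg hC (hws n) (hwc n)) le_rfl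
        _ = C * eLpNorm (w n) (P * 2) volume ^ 2 + eLpNorm (f n - Q) P volume := by
            rw [eLpNorm_norm_sq_eq_mul_two]
        _ ≤ C * (NU + δ n) ^ 2 + eLpNorm (f n - Q) P volume := by gcongr; exact hwN n
        _ = _ := add_comm _ _
    have hT : Tendsto (fun n => eLpNorm (f n - Q) P volume + C * (NU + δ n) ^ 2) atTop
        (𝓝 (0 + C * (NU + 0) ^ 2)) :=
      hlim.add (ENNReal.Tendsto.const_mul (ENNReal.Tendsto.pow (n := 2)
        (tendsto_const_nhds.add hδlim)) (Or.inr ENNReal.coe_ne_top))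
    have h := ge_of_tendsto' hT hle
    simpa using h
  · -- ## the weak pressure Poisson equation
    intro φ hφ hφc
    have hφ2 : ContDiff ℝ 2 φ := contDiff_infty.1 hφ 2
    haveI hT1 : ENNReal.HolderTriple P (ENNReal.ofReal (q / (q - 1))) 1 := holderTriple_conj hq
    -- each approximant: `∫ p̃[wₙ] Δφ = -∫ D²φ(wₙ, wₙ)`
    have hn : ∀ n, ∫ y, f n y * (Δ φ) y = -∫ y, fderiv ℝ (fderiv ℝ φ) y (w n y) (w n y) := by
      intro n
      have h := integral_normalisedPressure_mul_laplacian (hws n) (hwc n) hφ2 hφc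
      linarith
    -- left-hand sides converge
    have hΔc : Continuous (Δ φ) := FluidPDE.continuous_laplacian hφ2
    have hΔs : HasCompactSupport (Δ φ) :=
      hφc.mono' fun x hx => by
        contrapose! hx
        simp [FluidPDE.laplacian_eq_zero_of_notMem_tsupport hx]
    have hΔLp : MemLp (Δ φ) (ENNReal.ofReal (q / (q - 1))) volume :=
      hΔc.memLp_of_hasCompactSupport hΔs
    have hQl : LocallyIntegrable Q volume := hQ.locallyIntegrable hP1'
    have iQ : Integrable fun y => Q y * (Δ φ) y := by
      simpa only [smul_eq_mul] using hQl.integrable_smul_right_of_hasCompactSupport hΔc hΔs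
    have ifn : ∀ n, Integrable fun y => f n y * (Δ φ) y := fun n => by
      simpa only [smul_eq_mul] using
        ((hfP n).locallyIntegrable hP1').integrable_smul_right_of_hasCompactSupport hΔc hΔs
    have hL : Tendsto (fun n => ∫ y, f n y * (Δ φ) y) atTop (𝓝 (∫ y, Q y * (Δ φ) y)) := by
      have h0 := tendsto_integral_mul_of_eLpNorm_tendsto_zero (P := P)
        (Q' := ENNReal.ofReal (q / (q - 1))) (g := fun n => fun y => f n y - Q y) (ψ := Δ φ)
        (fun n => (hfP n).1.sub hQ.1) hΔLp hlim
      have e : ∀ n, ∫ y, (f n y - Q y) * (Δ φ) y = (∫ y, f n y * (Δ φ) y) - ∫ y, Q y * (Δ φ) y := by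
        intro n
        rw [← integral_sub (ifn n) iQ]
        refine integral_congr_ae (ae_of_all _ fun y => ?_)
        ring
      simp_rw [e] at h0
      exact tendsto_sub_nhds_zero_iff.1 h0
    -- right-hand sides converge
    have hlim' : Tendsto (fun n => eLpNorm (w n - U) (P * 2) volume) atTop (𝓝 0) := by
      refine tendsto_of_tendsto_of_tendsto_of_le_of_le tendsto_const_nhds hδlim (fun _ => zero_le)
        fun n => ?_
      rw [eLpNorm_sub_comm]
      exact hwU' n
    have hR := tendsto_integral_hessian_apply_of_eLpNorm hq hU hwLp
      (ENNReal.add_ne_top.2 ⟨hNUtop, ENNReal.one_ne_top⟩) hwN1 hlim' hφ2 hφc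
    -- conclude
    have hL' : Tendsto (fun n => ∫ y, f n y * (Δ φ) y) atTop
        (𝓝 (-∫ y, fderiv ℝ (fderiv ℝ φ) y (U y) (U y))) := by
      simp_rw [hn]
      exact hR.neg
    exact tendsto_nhds_unique hL hL'

end Main

/-! ## §5. Discharge of `nrs1996_rieszPressure`, Lemma 3.1, and Theorem 1 from the CKN inputs -/

section Discharge

/-- **Discharge of `nrs1996_rieszPressure`** (NRŠ 1996, §2, p. 285: the Riesz pressure
`RⱼRₖ(UⱼUₖ) ∈ L^q` of `U ∈ L^{2q}`, `‖P‖_q ≤ C_q ‖U‖²_{2q}`, solving (2.2) weakly): the named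
fact of `NecasRuzickaSverakPressure` holds, by `exists_rieszPressure` and the conversion between
`eLpNorm` and the `lintegral` form of the fact (the norm bound raised to the power `q`, constant
`C^q`). [cite: NecasRuzickaSverak1996, §2 p. 285 (with [CZ], [St])] -/
theorem nrs1996_rieszPressure_holds : nrs1996_rieszPressure := by
  intro q hq
  have hq0 : 0 < q := by linarith
  obtain ⟨C, hC⟩ := exists_rieszPressure hq
  set P : ℝ≥0∞ := ENNReal.ofReal q with hPdef
  have hP0 : P ≠ 0 := (ENNReal.ofReal_pos.2 hq0).ne'
  have hPtop : P ≠ ⊤ := ENNReal.ofReal_ne_top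
  have hP20 : P * 2 ≠ 0 := mul_ne_zero hP0 two_ne_zero
  have hP2top : P * 2 ≠ ⊤ := ENNReal.mul_ne_top hPtop ENNReal.ofNat_ne_top
  have hPr : P.toReal = q := ENNReal.toReal_ofReal hq0.le
  have hP2r : (P * 2).toReal = 2 * q := by
    rw [ENNReal.toReal_mul, hPr, ENNReal.toReal_ofNat]
    ring
  set C' : ℝ≥0∞ := (C : ℝ≥0∞) ^ q with hC'
  have hC'top : C' ≠ ⊤ := ENNReal.rpow_ne_top_of_nonneg hq0.le ENNReal.coe_ne_top
  refine ⟨C'.toNNReal, fun U hUm hIU => ?_⟩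
  -- `U ∈ L^{2q}`
  have hU : MemLp U (P * 2) volume := by
    refine ⟨hUm, ?_⟩
    rw [eLpNorm_lt_top_iff_lintegral_rpow_enorm_lt_top hP20 hP2top, hP2r]
    exact hIU
  obtain ⟨Q, hQ, hQbound, hQeq⟩ := hC U hU
  refine ⟨Q, hQ.1, ?_, hQeq⟩
  rw [ENNReal.coe_toNNReal hC'top]
  -- from `eLpNorm` to lower integrals
  have e1 : eLpNorm Q P volume = (∫⁻ y, ‖Q y‖ₑ ^ q) ^ (1 / q) := by
    rw [eLpNorm_eq_lintegral_rpow_enorm_toReal hP0 hPtop, hPr]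
  have e2 : eLpNorm U (P * 2) volume = (∫⁻ y, ‖U y‖ₑ ^ (2 * q)) ^ (1 / (2 * q)) := by
    rw [eLpNorm_eq_lintegral_rpow_enorm_toReal hP20 hP2top, hP2r]
  rw [e1, e2] at hQbound
  have h1 : ((∫⁻ y, ‖U y‖ₑ ^ (2 * q)) ^ (1 / (2 * q))) ^ 2 = (∫⁻ y, ‖U y‖ₑ ^ (2 * q)) ^ (1 / q) := by
    rw [← ENNReal.rpow_natCast, ← ENNReal.rpow_mul]
    congr 1
    push_cast
    field_simp
  rw [h1] at hQbound
  have h2 := ENNReal.rpow_le_rpow hQbound hq0.le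
  rw [← ENNReal.rpow_mul, one_div, inv_mul_cancel₀ hq0.ne', ENNReal.rpow_one,
    ENNReal.mul_rpow_of_nonneg _ _ hq0.le, ← ENNReal.rpow_mul, inv_mul_cancel₀ hq0.ne',
    ENNReal.rpow_one] at h2
  exact h2

/-- **NRŠ 1996, Lemma 3.1, discharged** (an `L³` Leray profile has a constant `c` with
`P − c ∈ L^{3/2}`): `nrs1996_lemma31_of_rieszPressure` applied to
`nrs1996_rieszPressure_holds`. [cite: NecasRuzickaSverak1996, Lemma 3.1 (p. 287) with §2 p. 285] -/
theorem nrs1996_lemma31_holds : nrs1996_lemma31 :=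
  nrs1996_lemma31_of_rieszPressure nrs1996_rieszPressure_holds

/-- **NRŠ 1996, Theorem 1, from the three shared inputs.** Every Leray profile `U ∈ L³(ℝ³)`
vanishes (`necas_ruzicka_sverak`), granted the regularity of weak solutions of (1.3)
(`tsai1998_profile_smooth`, NRŠ p. 287 = Tsai p. 33), the polynomial growth of the pressure
(`tsai1998_lemma32`, Tsai's Lemma 3.2 for `3 ≤ q ≤ ∞`) and the one-scale
Caffarelli–Kohn–Nirenberg criterion (`lemarieRieusset_epsilon_regularity`, NRŠ's Proposition 2.1
for `k = 0`); Lemma 3.1 (Calderón–Zygmund pressure and its Liouville identification), (3.5)–(3.6)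
for `k = 0`, (3.3), Lemma 3.3 and the maximum-principle endgame are proved in the tree.
[cite: NecasRuzickaSverak1996, Thm 1 (p. 291)] -/
theorem necas_ruzicka_sverak_of_CKN (hreg : tsai1998_profile_smooth) (h32 : tsai1998_lemma32)
    (hLR : lemarieRieusset_epsilon_regularity) : necas_ruzicka_sverak :=
  necas_ruzicka_sverak_of_rieszPressure hreg h32 hLR nrs1996_rieszPressure_holds

end Discharge

end Literature.Analysis.FluidPDE

end
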